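import Mathlib.Algebra.FreeAlgebra
import Literature.MathematicalPhysics.QuantumLattice.DWaveSource
import HarnessLib

/-!
# One-point SOS certificates for the sourced `d`-wave pair density on Hubbard tori

Trunk T-QLATTICE, family `hubbard`. Definition request `defn-DWaveOnePointCertificate` of route
`HubbardSuperconductivity/OneSidedBootstrap` (crux `StripeSourceCeiling`, foreseen support
`OnePointSoundness`, certified computation `StripeOnePointCertificate`); a NEW OBJECT posited by
that route (negative side; mirror image of the positive-side interface `GSCertificate` of route
`GSCertificate`), filed here next to `DWaveSource.lean`.

## The object

Fix a box size `R`. A **placed box polynomial** (`PlacedBoxPoly R`) is `L`-independent data: a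
base point `y ∈ ℤ²` and an element of the free complex algebra on the letters
`(v, σ, †?) ∈ {0,…,R-1}² × {↑,↓} × Bool` (`BoxLetter R`, `BoxPoly R = FreeAlgebra ℂ (BoxLetter R)`),
i.e. a non-commutative polynomial in abstract CAR generators `c^♯_{y+v,σ}` with complex
coefficients. On the torus of side `L` it is INTERPRETED (`PlacedBoxPoly.toMatrix L`) by sending
the letter `(v, σ, b)` to the Jordan–Wigner matrix `creation`/`annihilation` of the orbital
`(y + v mod L, σ)` (`FermionTorus.ofTorusSite ∘ Torus.proj L`) and extending multiplicatively
(`FreeAlgebra.lift`). Torus translations act on the data by shifting the base point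
(`PlacedBoxPoly.translate`), which is how "`τ_x` acting on CAR words by shifting sites" is encoded
without choosing a unitary.

A **one-point certificate of level `R` at `(H, O, η)`** (`TorusOnePointCertificate R H O η`, for
families `H L`, `O L` of matrices on the Fock spaces of the tori) consists of a threshold `L₀` and
finite lists of placed box polynomials — SOS generators `s_j`, KKT (state-optimality) multipliers
`a_k`, stationarity polynomials `b_m`, and translation-coboundary pairs `(x_i, B_i)` — such that for
every `L ≥ L₀` with `L ≠ 0` the operator identity
`η·1 - (O_L + O_L†)/2 = Σ_j s_j† s_j + Σ_k a_k† (H_L a_k - a_k H_L) + Σ_m (H_L b_m - b_m H_L)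
  + Σ_i (τ_{x_i} B_i - B_i)`
holds between matrices on `Fock((ℤ/Lℤ)²)`. The requested notion is the specialisation
`DWaveOnePointCertificate R U μ h η` to `H_L = dWaveSourceTorus L U μ h`
(`= hubbardTorusWith 2 L 1 U μ - h (Δ_d + Δ_d†)`) and `O_L = localPair dWaveFormFactor L 0` (the
local `d_{x²-y²}` pair at the origin).

Why this shape (the route's rationale, recorded): it is the matrix-identity dual of the level-`R`
state-optimality / NPA semidefinite relaxation "maximise `Re ω̃(P₀)` over translation-invariant
pseudo-expectations on box words subject to moment positivity, `ω̃([H,b]) = 0` and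
`ω̃(a†Ha - ½{H, a†a}) ≥ 0`" [cite: AraujoEtAl2023, §3.2 (state optimality conditions) and §6.1]
(also Wang et al. 2024, Fawzi–Fawzi–Scalet 2024, Kull et al. 2024), so numerically found duals
round to instances; and it is finite-dimensional for each `L`. SOUNDNESS — evaluating the identity
in the tracial ground-state functional `ω₀ = Matrix.groundStateFunctional (H_L)` (positive;
`ω₀(a†(Ha - aH)) = ω₀(a†(H - E₀)a) ≥ 0`; `ω₀(Hb - bH) = 0`; translation invariant because `H_L`
commutes with the torus translations, which implement `τ_x` on the interpreted polynomials) gives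
`Re ω₀(O_L) ≤ η`, hence `dWaveSourceDensity L U μ h = Re ω₀(Δ_d)/L² = Re ω₀(P₀) ≤ η` for
`L ≥ L₀` — is the route's support item `OnePointSoundness` and is NOT proved here.

## API

`PlacedBoxPoly.toMatrix_ι` (interpretation of a letter), `toMatrix_algebraMap`, `toMatrix_mul`,
`toMatrix_add`, `translate_zero`, `translate_translate`; `TorusOnePointCertificate.mono` (a certificate at `η` gives one at every
`η' ≥ η`, by adding the SOS generator `√(η'-η)·1`) and `DWaveOnePointCertificate.mono`.

## Design choices

* Lists (not finsets) of polynomials: duplicates are meaningful and order is immaterial.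
* `b` is a list too (the request allows "one arbitrary polynomial `b`"; a sum of box-supported
  `b`'s with different boxes is not one box polynomial).
* The interpretation needs `L ≠ 0` (`FermionTorus.ofTorusSite`), so the identity is required for
  `L ≥ L₀` under `[NeZero L]`; `L₀` should also exceed the box diameter so that supports do not
  wrap — this is the certificate author's responsibility, not enforced.
* Coefficients are complex (`FreeAlgebra ℂ`); certified instances will use rational/algebraic
  numerals. `U, μ, h` are fixed reals (the symbolic-box variant with SOS multipliers in the
  parameters is a possible later extension, as the request notes).
* Non-vacuity: genuine certificates are the object of the certified-computation item; the API
  lemma `mono` shows how instances transform. Every field is data or a matrix identity; nothing is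
  asserted about any `(U, μ, h, η)`.
-/

noncomputable section

namespace Literature.MathematicalPhysics.QuantumLattice

open Matrix Finset Literature.Probability.LatticeModels
open scoped ComplexOrder

/-! ### Box letters and abstract box polynomials -/

/-- A letter of the level-`R` box alphabet: an offset `v ∈ {0,…,R-1}²`, a spin `σ ∈ {↑,↓}` and a
dagger flag (`true` = creation operator `c†_{v,σ}`, `false` = annihilation `c_{v,σ}`).
[cite: AraujoEtAl2023, §6.1 (polynomials in local spin/fermion variables)] -/
abbrev BoxLetter (R : ℕ) : Type := (Fin 2 → Fin R) × Fin 2 × Bool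

/-- The offset of a letter as a point of `ℤ²`. [folklore] -/
def BoxLetter.offset {R : ℕ} (a : BoxLetter R) : Site 2 := fun i => ((a.1 i : ℕ) : ℤ)

/-- Abstract (`L`-independent) non-commutative polynomials in the box CAR generators: the free
complex algebra on `BoxLetter R`. [cite: AraujoEtAl2023, §2 (non-commutative polynomials)] -/
abbrev BoxPoly (R : ℕ) : Type := FreeAlgebra ℂ (BoxLetter R)

/-- A box polynomial PLACED at a base point `y ∈ ℤ²`: it stands for the polynomial in the
generators `c^♯_{y+v,σ}`, `v ∈ {0,…,R-1}²` — supported in the translate `y + {0,…,R-1}²` of the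
`R`-box. [cite: AraujoEtAl2023, §6.1 (translation-invariant local polynomials)] -/
structure PlacedBoxPoly (R : ℕ) where
  /-- The base point (lower-left corner of the supporting box). -/
  base : Site 2
  /-- The abstract polynomial in the box letters. -/
  poly : BoxPoly R

namespace PlacedBoxPoly

variable {R : ℕ}

/-- Torus translations act on placed polynomials by shifting the base point: `τ_x (y, p) = (y + x, p)`.
[cite: AraujoEtAl2023, §6.1 (translation *-isomorphisms)] -/
def translate (x : Site 2) (q : PlacedBoxPoly R) : PlacedBoxPoly R := ⟨q.base + x, q.poly⟩

/-- Translating by `0` does nothing. [folklore] -/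
@[simp] theorem translate_zero (q : PlacedBoxPoly R) : q.translate 0 = q := by
  cases q; simp [translate]

/-- Translations compose additively. [folklore] -/
theorem translate_translate (x x' : Site 2) (q : PlacedBoxPoly R) :
    (q.translate x).translate x' = q.translate (x + x') := by
  cases q; simp [translate, add_assoc]

/-- The base point of a translate. [folklore] -/
@[simp] theorem base_translate (x : Site 2) (q : PlacedBoxPoly R) : (q.translate x).base = q.base + x :=
  rfl

/-- The abstract polynomial is unchanged by translation. [folklore] -/
@[simp] theorem poly_translate (x : Site 2) (q : PlacedBoxPoly R) : (q.translate x).poly = q.poly :=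
  rfl

variable (L : ℕ) [NeZero L]

/-- The Jordan–Wigner matrix on the torus of side `L` of the letter `a = (v, σ, b)` placed at `y`:
`c†_{(y+v) mod L, σ}` if `b`, else `c_{(y+v) mod L, σ}` (`creation`/`annihilation` of the orbital
`orb (FermionTorus.ofTorusSite (Torus.proj L (y + v))) σ`). [folklore] -/
def letterMatrix (y : Site 2) (a : BoxLetter R) :
    Matrix (Finset (Orb (FermionTorus 2 L))) (Finset (Orb (FermionTorus 2 L))) ℂ :=
  if a.2.2 then creation (orb (FermionTorus.ofTorusSite (Torus.proj L (y + a.offset))) a.2.1)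
  else annihilation (orb (FermionTorus.ofTorusSite (Torus.proj L (y + a.offset))) a.2.1)

/-- The interpretation on the torus of side `L` of polynomials placed at `y`, as a `ℂ`-algebra
homomorphism `BoxPoly R →ₐ[ℂ] Matrix …` (`FreeAlgebra.lift` of `letterMatrix L y`). [folklore] -/
def interp (y : Site 2) :
    BoxPoly R →ₐ[ℂ] Matrix (Finset (Orb (FermionTorus 2 L))) (Finset (Orb (FermionTorus 2 L))) ℂ :=
  FreeAlgebra.lift ℂ (letterMatrix L y)

/-- The matrix on `Fock((ℤ/Lℤ)²)` denoted by a placed box polynomial. [folklore] -/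
def toMatrix (q : PlacedBoxPoly R) :
    Matrix (Finset (Orb (FermionTorus 2 L))) (Finset (Orb (FermionTorus 2 L))) ℂ :=
  interp L q.base q.poly

/-- A single letter is interpreted by its Jordan–Wigner matrix. [folklore] -/
@[simp] theorem interp_ι (y : Site 2) (a : BoxLetter R) :
    interp L y (FreeAlgebra.ι ℂ a) = letterMatrix L y a := by
  simp [interp]

/-- `toMatrix` of a letter placed at `y`. [folklore] -/
theorem toMatrix_ι (y : Site 2) (a : BoxLetter R) :
    toMatrix L ⟨y, FreeAlgebra.ι ℂ a⟩ = letterMatrix L y a :=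
  interp_ι L y a

/-- `toMatrix` of a scalar is the scalar matrix. [folklore] -/
theorem toMatrix_algebraMap (y : Site 2) (c : ℂ) :
    toMatrix L ⟨y, algebraMap ℂ (BoxPoly R) c⟩ = c • (1 : Matrix _ _ ℂ) := by
  simp [toMatrix, Algebra.algebraMap_eq_smul_one]

/-- `toMatrix` is multiplicative in the abstract polynomial. [folklore] -/
theorem toMatrix_mul (y : Site 2) (p p' : BoxPoly R) :
    toMatrix L ⟨y, p * p'⟩ = toMatrix L ⟨y, p⟩ * toMatrix L ⟨y, p'⟩ := by
  simp [toMatrix]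

/-- `toMatrix` is additive in the abstract polynomial. [folklore] -/
theorem toMatrix_add (y : Site 2) (p p' : BoxPoly R) :
    toMatrix L ⟨y, p + p'⟩ = toMatrix L ⟨y, p⟩ + toMatrix L ⟨y, p'⟩ := by
  simp [toMatrix]

end PlacedBoxPoly

/-! ### One-point certificates -/

/-- **One-point SOS certificate of level `R` at `(H, O, η)` on the Hubbard tori** (generic form):
`L`-independent data — a threshold `L₀`, SOS generators `sos = [s_j]`, state-optimality (KKT)
multipliers `kkt = [a_k]`, stationarity polynomials `stat = [b_m]` and translation coboundaries
`cob = [(x_i, B_i)]`, all placed box polynomials of level `R` — together with the operator identity,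
for every `L ≥ L₀`, `L ≠ 0`:
`η·1 - (O_L + O_L†)/2 = Σ_j s_j†s_j + Σ_k a_k†(H_L a_k - a_k H_L) + Σ_m (H_L b_m - b_m H_L)
  + Σ_i (τ_{x_i}B_i - B_i)`
in `Matrix (Finset (Orb (FermionTorus 2 L))) (Finset (Orb (FermionTorus 2 L))) ℂ`, where each
placed polynomial is read through `PlacedBoxPoly.toMatrix L` and `τ_x` is
`PlacedBoxPoly.translate x`. The dual form of the state-optimality SDP relaxation for local
ground-state observables of translation-invariant Hamiltonians.
[cite: AraujoEtAl2023, §3.2 eq. (state optimality) and §6.1] -/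
structure TorusOnePointCertificate (R : ℕ)
    (H O : (L : ℕ) → [NeZero L] →
      Matrix (Finset (Orb (FermionTorus 2 L))) (Finset (Orb (FermionTorus 2 L))) ℂ)
    (η : ℝ) where
  /-- Threshold side length (should exceed the box diameter so that supports do not wrap). -/
  L₀ : ℕ
  /-- SOS generators `s_j`. -/
  sos : List (PlacedBoxPoly R)
  /-- State-optimality (KKT) multipliers `a_k`. -/
  kkt : List (PlacedBoxPoly R)
  /-- Stationarity polynomials `b_m`. -/
  stat : List (PlacedBoxPoly R)
  /-- Translation coboundaries `(x_i, B_i)`. -/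
  cob : List (Site 2 × PlacedBoxPoly R)
  /-- The operator identity on every torus of side `L ≥ L₀`, `L ≠ 0`. -/
  identity : ∀ (L : ℕ) [NeZero L], L₀ ≤ L →
    (η : ℂ) • (1 : Matrix _ _ ℂ) - (1 / 2 : ℂ) • (O L + (O L)ᴴ) =
      (sos.map fun s => (s.toMatrix L)ᴴ * s.toMatrix L).sum +
        (kkt.map fun a => (a.toMatrix L)ᴴ * (H L * a.toMatrix L - a.toMatrix L * H L)).sum +
        (stat.map fun b => H L * b.toMatrix L - b.toMatrix L * H L).sum +
        (cob.map fun xB => (xB.2.translate xB.1).toMatrix L - xB.2.toMatrix L).sum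

/-- **`DWaveOnePointCertificate R U μ h η`** — the requested notion: a one-point SOS certificate of
level `R` for the sourced grand-canonical Hubbard Hamiltonian
`H_L = dWaveSourceTorus L U μ h = hubbardTorusWith 2 L 1 U μ - h (Δ_d + Δ_d†)` and the local
`d_{x²-y²}` pair at the origin `O_L = P₀ = localPair dWaveFormFactor L 0`; it certifies (route
`OneSidedBootstrap`, support `OnePointSoundness`, not proved here) that the sourced `d`-wave density
`dWaveSourceDensity L U μ h = Re ω₀(P₀)` is `≤ η` for all `L ≥ L₀`.
[cite: AraujoEtAl2023, §3.2 and §6.1] -/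
abbrev DWaveOnePointCertificate (R : ℕ) (U μ h η : ℝ) : Type :=
  TorusOnePointCertificate R (fun L _ => dWaveSourceTorus L U μ h)
    (fun L _ => localPair dWaveFormFactor L 0) η

/-! ### API -/

namespace TorusOnePointCertificate

variable {R : ℕ}
  {H O : (L : ℕ) → [NeZero L] →
    Matrix (Finset (Orb (FermionTorus 2 L))) (Finset (Orb (FermionTorus 2 L))) ℂ}
  {η η' : ℝ}

/-- **Monotonicity in the level `η`.** A certificate at `η` yields one at every `η' ≥ η`: prepend the
SOS generator `√(η' - η) · 1` (placed anywhere), whose square is `(η' - η)·1`. [folklore] -/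
def mono (hle : η ≤ η') (C : TorusOnePointCertificate R H O η) : TorusOnePointCertificate R H O η' where
  L₀ := C.L₀
  sos := ⟨0, algebraMap ℂ (BoxPoly R) (Real.sqrt (η' - η) : ℂ)⟩ :: C.sos
  kkt := C.kkt
  stat := C.stat
  cob := C.cob
  identity L _ hL := by
    have hC := C.identity L hL
    have hsq : ((Real.sqrt (η' - η) : ℂ) • (1 : Matrix (Finset (Orb (FermionTorus 2 L)))
        (Finset (Orb (FermionTorus 2 L))) ℂ))ᴴ * ((Real.sqrt (η' - η) : ℂ) • 1) =
        ((η' - η : ℝ) : ℂ) • 1 := by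
      rw [conjTranspose_smul, conjTranspose_one, smul_mul_smul_comm, one_mul, Complex.star_def,
        Complex.conj_ofReal, ← Complex.ofReal_mul, Real.mul_self_sqrt (sub_nonneg.2 hle)]
    have key : (η' : ℂ) • (1 : Matrix (Finset (Orb (FermionTorus 2 L))) (Finset (Orb (FermionTorus 2 L))) ℂ)
        - (1 / 2 : ℂ) • (O L + (O L)ᴴ) =
        ((η' - η : ℝ) : ℂ) • 1 + ((η : ℂ) • 1 - (1 / 2 : ℂ) • (O L + (O L)ᴴ)) := by
      rw [Complex.ofReal_sub, sub_smul]
      abel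
    rw [key, hC]
    simp only [List.map_cons, List.sum_cons, PlacedBoxPoly.toMatrix_algebraMap, hsq]
    abel

end TorusOnePointCertificate

/-- Monotonicity of `d`-wave one-point certificates in `η`. [folklore] -/
def DWaveOnePointCertificate.mono {R : ℕ} {U μ h η η' : ℝ} (hle : η ≤ η')
    (C : DWaveOnePointCertificate R U μ h η) : DWaveOnePointCertificate R U μ h η' :=
  TorusOnePointCertificate.mono hle C

/-- A certificate at `η` gives `Nonempty` certificates at all larger levels (the form consumed by
the route items `OnePointSoundness` / `StripeOnePointCertificate`). [folklore] -/
theorem DWaveOnePointCertificate.nonempty_mono {R : ℕ} {U μ h η η' : ℝ} (hle : η ≤ η')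
    (hC : Nonempty (DWaveOnePointCertificate R U μ h η)) :
    Nonempty (DWaveOnePointCertificate R U μ h η') :=
  hC.map (DWaveOnePointCertificate.mono hle)

end Literature.MathematicalPhysics.QuantumLattice

end
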